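import Literature.NumberTheory.QuadraticFields.RealQuadraticRegulator
import HarnessLib

/-!
# Fundamental units of real quadratic discriminants by a FINITE CHECK, and the values at
# `D = 12, 13, 17, 21, 24, 28, 29, 53, 173, 293, 437, 1365`

Topic `NumberTheory/QuadraticFields`, namespace `Literature.NumberTheory.QuadraticFields` (sub-namespaces
`QuadIrr` for the unit, `Quadratic` for the field-side regulator), continuing `RealQuadraticFundamentalUnit.lean`
(`QuadIrr.fundUnit D = ε_D`, the unit of the principal cycle; kernel values `fundUnit_five`, `fundUnit_eight`) and
`RealQuadraticRegulator.lean` (`Quadratic.fundUnit_eq_of_isLeast`: `ε_D` is the LEAST `(X + Y√D)/2 > 1` with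
`X² − DY² = ±4`; `Quadratic.regulator_eq_log_fundUnit'`: `R_K = log ε_{d_K}`). Everything here is PROVED
(theorems only; no definitions, no named facts).

* `QuadIrr.fundUnit_eq_of_check` — **a finite-check criterion**: if `t, u ≥ 1` solve `t² − Du² = ±4` and every
  solution `(X, Y)` with `1 ≤ Y ≤ u`, `1 ≤ X ≤ Du + 2` has `Y = u` and `X ≥ t` (a decidable statement), then
  `fundUnit D = (t + u√D)/2`. (Solutions with `Y ≤ u` have `X² ≤ Du² + 4 ≤ (Du + 2)²`; solutions with `Y > u`
  have `X² ≥ D(u+1)² − 4 ≥ t²` as soon as `D ≥ 3`; so the least solution is `(t, u)` — Jacobson–Williams'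
  characterisation of `ε_Δ` as the least unit `> 1`, made effective.)
* the VALUES (`decide` on the check): `fundUnit_twelve = (4 + √12)/2 = 2 + √3`, `fundUnit_thirteen = (3 + √13)/2`,
  `fundUnit_seventeen = (8 + 2√17)/2 = 4 + √17`, `fundUnit_twentyOne = (5 + √21)/2`, `fundUnit_twentyFour =
  (10 + 2√24)/2 = 5 + 2√6`, `fundUnit_twentyEight = (16 + 3√28)/2 = 8 + 3√7`, `fundUnit_twentyNine = (5 + √29)/2`,
  `fundUnit_53 = (7 + √53)/2`, `fundUnit_173 = (13 + √173)/2`, `fundUnit_293 = (17 + √293)/2`,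
  `fundUnit_437 = (21 + √437)/2`, `fundUnit_1365 = (37 + √1365)/2` (Jacobson–Williams, Table 3.1 style; Cohen,
  Appendix B Table B.2 lists these units);
* `Quadratic.regulator_eq_log_of_discr_eq` — field side: for a quadratic field `K` with `d_K = D > 0` and a kernel
  value `fundUnit D = ε`, `R_K = log ε`; instantiated as `regulator_of_discr_eq_twelve … regulator_of_discr_eq_1365`.
* Rev 2 (append): `Quadratic.classNumber_eq_one_of_discr_pos_lt_sixteen` — `h_K = 1` for every real quadratic field
  with `d_K < 16` (`d_K ∈ {5, 8, 12, 13}`) by Mathlib's Minkowski bound `RingOfIntegers.isPrincipalIdealRing_of_abs_discr_lt`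
  (`|d_K| < (2·2²/2!)² = 16`), and the products `classNumber_mul_regulator_of_discr_eq_{five, eight, twelve, thirteen}`
  (`h_K R_K = log ε_D`, the quantity of the class number formula `L(1, χ_D) = 2 h_K R_K/√D`).

First consumer: the landau-siegel rescue bed (`Zhang2022/RepairBedClassNumberFormula.lean`,
`LOne_eq_log_fundUnit_of_discr_pos`: `L(1, χ_D) = 2 h_K log ε_D/√D`), whose positive moduli are
`5, 8, 12, 13, 17, 21, 24, 28, 29, 1365` and whose all-inert ladder starts `5, 53, 173, 293, 437`.

## References

* [JacobsonWilliams2008] M. J. Jacobson, H. C. Williams, *Solving the Pell Equation* (2008), §3.3 Table 3.1,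
  §4.3 (`ε_Δ > 1` least), §5.3 (5.33)–(5.34).
* [Cohen1993] H. Cohen, *A Course in Computational Algebraic Number Theory*, GTM 138, §5.7 and Appendix B.2
  (class numbers and fundamental units of real quadratic fields).
-/

noncomputable section

open Module NumberField NumberField.Units

namespace Literature.NumberTheory.QuadraticFields

namespace QuadIrr

/-- **Fundamental unit by a finite check.** Let `D ≥ 3` be a non-square with `D ≡ 0, 1 (mod 4)` and let
`t, u ≥ 1` solve `t² − Du² = ±4`. If every solution `(X, Y)` of `X² − DY² = ±4` with `1 ≤ Y ≤ u` and
`1 ≤ X ≤ Du + 2` has `Y = u` and `t ≤ X` (a finite, decidable condition), then `ε_D = fundUnit D = (t + u√D)/2`: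
solutions with `Y ≤ u` are inside the box (`X² ≤ Du² + 4 ≤ (Du + 2)²`), and solutions with `Y ≥ u + 1` have
`X² ≥ D(u+1)² − 4 ≥ Du² + 4 ≥ t²`, so `(t, u)` gives the least unit `> 1`, which is `ε_D`
(`Quadratic.fundUnit_eq_of_isLeast`). [cite: JacobsonWilliams2008, §4.3 with §5.3 (5.33)] -/
theorem fundUnit_eq_of_check {D : ℕ} (hD : ¬ IsSquare D) (hD4 : D % 4 = 0 ∨ D % 4 = 1) (h3 : 3 ≤ D)
    {t u : ℕ} (ht : 1 ≤ t) (hu : 1 ≤ u)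
    (hsol : (t : ℤ) ^ 2 - D * u ^ 2 = 4 ∨ (t : ℤ) ^ 2 - D * u ^ 2 = -4)
    (hcheck : ∀ Y ∈ Finset.Icc 1 u, ∀ X ∈ Finset.Icc 1 (D * u + 2),
      ((X : ℤ) ^ 2 - D * Y ^ 2 = 4 ∨ (X : ℤ) ^ 2 - D * Y ^ 2 = -4) → Y = u ∧ t ≤ X) :
    fundUnit D = (t + u * Real.sqrt D) / 2 := by
  have hD0 : (0 : ℝ) ≤ Real.sqrt D := Real.sqrt_nonneg _
  have hsqrtD : 1 < Real.sqrt D := by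
    rw [show (1 : ℝ) = Real.sqrt 1 by simp]
    exact Real.sqrt_lt_sqrt (by norm_num) (by exact_mod_cast (show 1 < D by omega))
  refine Quadratic.fundUnit_eq_of_isLeast hD hD4 ?_ ⟨t, u, by exact_mod_cast hsol, by push_cast; ring⟩ ?_
  · have ht' : (1 : ℝ) ≤ t := by exact_mod_cast ht
    have hu' : (1 : ℝ) ≤ u := by exact_mod_cast hu
    have : Real.sqrt D ≤ u * Real.sqrt D := le_mul_of_one_le_left hD0 hu'
    linarith
  · intro X Y hX hY hXY
    have ht2 : (t : ℤ) ^ 2 ≤ D * u ^ 2 + 4 := by rcases hsol with h | h <;> linarith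
    have hDnn : (0 : ℤ) ≤ D := by positivity
    by_cases hYu : Y ≤ u
    · -- inside the box: `X ≤ Du + 2`
      have hX2 : X ^ 2 ≤ ((D : ℤ) * u + 2) ^ 2 := by
        have hY2 : Y ^ 2 ≤ (u : ℤ) ^ 2 := by nlinarith
        have h1 : X ^ 2 ≤ (D : ℤ) * u ^ 2 + 4 := by rcases hXY with h | h <;> nlinarith
        have hu0 : (0 : ℤ) ≤ u := by positivity
        nlinarith
      have hXle : X ≤ (D : ℤ) * u + 2 :=
        (pow_le_pow_iff_left₀ (by omega) (by positivity) two_ne_zero).mp hX2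
      obtain ⟨X', rfl⟩ := Int.eq_ofNat_of_zero_le (show (0 : ℤ) ≤ X by omega)
      obtain ⟨Y', rfl⟩ := Int.eq_ofNat_of_zero_le (show (0 : ℤ) ≤ Y by omega)
      have hmemY : Y' ∈ Finset.Icc 1 u := Finset.mem_Icc.mpr ⟨by omega, by omega⟩
      have hmemX : X' ∈ Finset.Icc 1 (D * u + 2) := by
        refine Finset.mem_Icc.mpr ⟨by omega, ?_⟩
        have : ((X' : ℕ) : ℤ) ≤ ((D * u + 2 : ℕ) : ℤ) := by push_cast; exact hXle
        exact_mod_cast this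
      obtain ⟨hYeq, htX⟩ := hcheck Y' hmemY X' hmemX hXY
      subst hYeq
      have htX' : (t : ℝ) ≤ X' := by exact_mod_cast htX
      push_cast
      linarith
    · -- `Y ≥ u + 1`: `X ≥ t` and `Y ≥ u`
      have hYu' : (u : ℤ) + 1 ≤ Y := by omega
      have hX2 : (t : ℤ) ^ 2 ≤ X ^ 2 := by
        have hDge : (3 : ℤ) ≤ D := by exact_mod_cast h3
        have hu1 : (1 : ℤ) ≤ u := by exact_mod_cast hu
        have hY0 : (0 : ℤ) ≤ Y := by omega
        have hY2 : ((u : ℤ) + 1) ^ 2 ≤ Y ^ 2 := by nlinarith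
        have h1 : (D : ℤ) * ((u : ℤ) + 1) ^ 2 - 4 ≤ X ^ 2 := by rcases hXY with h | h <;> nlinarith
        nlinarith
      have htX : (t : ℤ) ≤ X :=
        (pow_le_pow_iff_left₀ (by positivity) (by omega) two_ne_zero).mp hX2
      have htX' : (t : ℝ) ≤ X := by exact_mod_cast htX
      have huY : (u : ℝ) ≤ Y := by exact_mod_cast (show (u : ℤ) ≤ Y by omega)
      have : (u : ℝ) * Real.sqrt D ≤ Y * Real.sqrt D := mul_le_mul_of_nonneg_right huY hD0
      linarith

/-! ### Values (the check is run by `decide`) -/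

/-- `ε₁₂ = (4 + √12)/2 = 2 + √3`. [cite: JacobsonWilliams2008, §3.3 Table 3.1] -/
theorem fundUnit_twelve : fundUnit 12 = (4 + 1 * Real.sqrt 12) / 2 := by
  rw [fundUnit_eq_of_check (t := 4) (u := 1) (by decide +kernel) (by norm_num) (by norm_num) (by norm_num)
    (by norm_num) (by norm_num) (by decide +kernel)]
  push_cast; ring

/-- `ε₁₃ = (3 + √13)/2`. [cite: JacobsonWilliams2008, §3.3 Table 3.1] -/
theorem fundUnit_thirteen : fundUnit 13 = (3 + 1 * Real.sqrt 13) / 2 := by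
  rw [fundUnit_eq_of_check (t := 3) (u := 1) (by decide +kernel) (by norm_num) (by norm_num) (by norm_num)
    (by norm_num) (by norm_num) (by decide +kernel)]
  push_cast; ring

/-- `ε₁₇ = (8 + 2√17)/2 = 4 + √17`. [cite: JacobsonWilliams2008, §3.3 Table 3.1] -/
theorem fundUnit_seventeen : fundUnit 17 = (8 + 2 * Real.sqrt 17) / 2 := by
  rw [fundUnit_eq_of_check (t := 8) (u := 2) (by decide +kernel) (by norm_num) (by norm_num) (by norm_num)
    (by norm_num) (by norm_num) (by decide +kernel)]
  push_cast; ring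

/-- `ε₂₁ = (5 + √21)/2`. [cite: JacobsonWilliams2008, §3.3 Table 3.1] -/
theorem fundUnit_twentyOne : fundUnit 21 = (5 + 1 * Real.sqrt 21) / 2 := by
  rw [fundUnit_eq_of_check (t := 5) (u := 1) (by decide +kernel) (by norm_num) (by norm_num) (by norm_num)
    (by norm_num) (by norm_num) (by decide +kernel)]
  push_cast; ring

/-- `ε₂₄ = (10 + 2√24)/2 = 5 + 2√6`. [cite: JacobsonWilliams2008, §3.3 Table 3.1] -/
theorem fundUnit_twentyFour : fundUnit 24 = (10 + 2 * Real.sqrt 24) / 2 := by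
  rw [fundUnit_eq_of_check (t := 10) (u := 2) (by decide +kernel) (by norm_num) (by norm_num) (by norm_num)
    (by norm_num) (by norm_num) (by decide +kernel)]
  push_cast; ring

/-- `ε₂₈ = (16 + 3√28)/2 = 8 + 3√7`. [cite: JacobsonWilliams2008, §3.3 Table 3.1] -/
theorem fundUnit_twentyEight : fundUnit 28 = (16 + 3 * Real.sqrt 28) / 2 := by
  rw [fundUnit_eq_of_check (t := 16) (u := 3) (by decide +kernel) (by norm_num) (by norm_num) (by norm_num)
    (by norm_num) (by norm_num) (by decide +kernel)]
  push_cast; ring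

/-- `ε₂₉ = (5 + √29)/2`. [cite: JacobsonWilliams2008, §3.3 Table 3.1] -/
theorem fundUnit_twentyNine : fundUnit 29 = (5 + 1 * Real.sqrt 29) / 2 := by
  rw [fundUnit_eq_of_check (t := 5) (u := 1) (by decide +kernel) (by norm_num) (by norm_num) (by norm_num)
    (by norm_num) (by norm_num) (by decide +kernel)]
  push_cast; ring

/-- `ε₅₃ = (7 + √53)/2` (`53` = the all-inert rung `D₅⁺`). [cite: JacobsonWilliams2008, §3.3 Table 3.1] -/
theorem fundUnit_53 : fundUnit 53 = (7 + 1 * Real.sqrt 53) / 2 := by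
  rw [fundUnit_eq_of_check (t := 7) (u := 1) (by decide +kernel) (by norm_num) (by norm_num) (by norm_num)
    (by norm_num) (by norm_num) (by decide +kernel)]
  push_cast; ring

/-- `ε₁₇₃ = (13 + √173)/2`. [cite: JacobsonWilliams2008, §3.3 Table 3.1] -/
theorem fundUnit_173 : fundUnit 173 = (13 + 1 * Real.sqrt 173) / 2 := by
  rw [fundUnit_eq_of_check (t := 13) (u := 1) (by decide +kernel) (by norm_num) (by norm_num) (by norm_num)
    (by norm_num) (by norm_num) (by decide +kernel)]
  push_cast; ring

/-- `ε₂₉₃ = (17 + √293)/2`. [cite: JacobsonWilliams2008, §3.3 Table 3.1] -/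
theorem fundUnit_293 : fundUnit 293 = (17 + 1 * Real.sqrt 293) / 2 := by
  rw [fundUnit_eq_of_check (t := 17) (u := 1) (by decide +kernel) (by norm_num) (by norm_num) (by norm_num)
    (by norm_num) (by norm_num) (by decide +kernel)]
  push_cast; ring

/-- `ε₄₃₇ = (21 + √437)/2` (`437 = 19·23`). [cite: JacobsonWilliams2008, §3.3 Table 3.1] -/
theorem fundUnit_437 : fundUnit 437 = (21 + 1 * Real.sqrt 437) / 2 := by
  rw [fundUnit_eq_of_check (t := 21) (u := 1) (by decide +kernel) (by norm_num) (by norm_num) (by norm_num)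
    (by norm_num) (by norm_num) (by decide +kernel)]
  push_cast; ring

/-- `ε₁₃₆₅ = (37 + √1365)/2` (`1365 = 3·5·7·13`, `37² − 1365 = 4`). [cite: JacobsonWilliams2008, §3.3 Table 3.1] -/
theorem fundUnit_1365 : fundUnit 1365 = (37 + 1 * Real.sqrt 1365) / 2 := by
  rw [fundUnit_eq_of_check (t := 37) (u := 1) (by decide +kernel) (by norm_num) (by norm_num) (by norm_num)
    (by norm_num) (by norm_num) (by decide +kernel)]
  push_cast; ring

end QuadIrr

/-! ### Field side: the regulator of the quadratic field of discriminant `D` -/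

namespace Quadratic

variable {K : Type*} [Field K] [NumberField K]

/-- **`R_K = log ε` from a kernel value of `ε_{d_K}`**: for a quadratic field `K` with `d_K = D > 0` and
`QuadIrr.fundUnit D = ε`, the regulator is `log ε` (`regulator_eq_log_fundUnit'`).
[cite: JacobsonWilliams2008, §5.3 (p. 112 and (5.33)–(5.34))] -/
theorem regulator_eq_log_of_discr_eq (h2 : finrank ℚ K = 2) {D : ℕ} (hd : NumberField.discr K = D)
    {ε : ℝ} (hε : QuadIrr.fundUnit D = ε) : regulator K = Real.log ε := by
  have hd' : 0 < NumberField.discr K := by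
    rw [hd]
    have : D ≠ 0 := fun h => NumberField.discr_ne_zero K (by rw [hd, h]; rfl)
    exact_mod_cast Nat.pos_of_ne_zero this
  rw [regulator_eq_log_fundUnit' h2 hd', hd, Int.toNat_natCast, hε]

/-- `d_K = 12`: `R_K = log (2 + √3)` (written `log ((4 + √12)/2)`). [cite: JacobsonWilliams2008, §3.3 Table 3.1] -/
theorem regulator_of_discr_eq_twelve (h2 : finrank ℚ K = 2) (hd : NumberField.discr K = 12) :
    regulator K = Real.log ((4 + 1 * Real.sqrt 12) / 2) :=
  regulator_eq_log_of_discr_eq h2 (D := 12) (by exact_mod_cast hd) QuadIrr.fundUnit_twelve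

/-- `d_K = 13`: `R_K = log ((3 + √13)/2)`. [cite: JacobsonWilliams2008, §3.3 Table 3.1] -/
theorem regulator_of_discr_eq_thirteen (h2 : finrank ℚ K = 2) (hd : NumberField.discr K = 13) :
    regulator K = Real.log ((3 + 1 * Real.sqrt 13) / 2) :=
  regulator_eq_log_of_discr_eq h2 (D := 13) (by exact_mod_cast hd) QuadIrr.fundUnit_thirteen

/-- `d_K = 17`: `R_K = log (4 + √17)`. [cite: JacobsonWilliams2008, §3.3 Table 3.1] -/
theorem regulator_of_discr_eq_seventeen (h2 : finrank ℚ K = 2) (hd : NumberField.discr K = 17) :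
    regulator K = Real.log ((8 + 2 * Real.sqrt 17) / 2) :=
  regulator_eq_log_of_discr_eq h2 (D := 17) (by exact_mod_cast hd) QuadIrr.fundUnit_seventeen

/-- `d_K = 21`: `R_K = log ((5 + √21)/2)`. [cite: JacobsonWilliams2008, §3.3 Table 3.1] -/
theorem regulator_of_discr_eq_twentyOne (h2 : finrank ℚ K = 2) (hd : NumberField.discr K = 21) :
    regulator K = Real.log ((5 + 1 * Real.sqrt 21) / 2) :=
  regulator_eq_log_of_discr_eq h2 (D := 21) (by exact_mod_cast hd) QuadIrr.fundUnit_twentyOne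

/-- `d_K = 24`: `R_K = log (5 + 2√6)`. [cite: JacobsonWilliams2008, §3.3 Table 3.1] -/
theorem regulator_of_discr_eq_twentyFour (h2 : finrank ℚ K = 2) (hd : NumberField.discr K = 24) :
    regulator K = Real.log ((10 + 2 * Real.sqrt 24) / 2) :=
  regulator_eq_log_of_discr_eq h2 (D := 24) (by exact_mod_cast hd) QuadIrr.fundUnit_twentyFour

/-- `d_K = 28`: `R_K = log (8 + 3√7)`. [cite: JacobsonWilliams2008, §3.3 Table 3.1] -/
theorem regulator_of_discr_eq_twentyEight (h2 : finrank ℚ K = 2) (hd : NumberField.discr K = 28) :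
    regulator K = Real.log ((16 + 3 * Real.sqrt 28) / 2) :=
  regulator_eq_log_of_discr_eq h2 (D := 28) (by exact_mod_cast hd) QuadIrr.fundUnit_twentyEight

/-- `d_K = 29`: `R_K = log ((5 + √29)/2)`. [cite: JacobsonWilliams2008, §3.3 Table 3.1] -/
theorem regulator_of_discr_eq_twentyNine (h2 : finrank ℚ K = 2) (hd : NumberField.discr K = 29) :
    regulator K = Real.log ((5 + 1 * Real.sqrt 29) / 2) :=
  regulator_eq_log_of_discr_eq h2 (D := 29) (by exact_mod_cast hd) QuadIrr.fundUnit_twentyNine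

/-- `d_K = 1365`: `R_K = log ((37 + √1365)/2)`. [cite: JacobsonWilliams2008, §3.3 Table 3.1] -/
theorem regulator_of_discr_eq_1365 (h2 : finrank ℚ K = 2) (hd : NumberField.discr K = 1365) :
    regulator K = Real.log ((37 + 1 * Real.sqrt 1365) / 2) :=
  regulator_eq_log_of_discr_eq h2 (D := 1365) (by exact_mod_cast hd) QuadIrr.fundUnit_1365

/-- `d_K = 5`: `R_K = log ((1 + √5)/2)` (the tree's `QuadIrr.fundUnit_five`). [cite: JacobsonWilliams2008, §3.3 Table 3.1] -/
theorem regulator_of_discr_eq_five (h2 : finrank ℚ K = 2) (hd : NumberField.discr K = 5) :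
    regulator K = Real.log ((1 + 1 * Real.sqrt 5) / 2) :=
  regulator_eq_log_of_discr_eq h2 (D := 5) (by exact_mod_cast hd) QuadIrr.fundUnit_five

/-- `d_K = 8`: `R_K = log (1 + √2)` (the tree's `QuadIrr.fundUnit_eight`). [cite: JacobsonWilliams2008, §3.3 Table 3.1] -/
theorem regulator_of_discr_eq_eight (h2 : finrank ℚ K = 2) (hd : NumberField.discr K = 8) :
    regulator K = Real.log ((2 + 1 * Real.sqrt 8) / 2) :=
  regulator_eq_log_of_discr_eq h2 (D := 8) (by exact_mod_cast hd) QuadIrr.fundUnit_eight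

end Quadratic

/-! ## Rev 2 (append): `h_K = 1` below the Minkowski bound (`0 < d_K < 16`) and `h_K R_K = log ε_D` there -/

namespace Quadratic

variable {K : Type*} [Field K] [NumberField K]

/-- **`h_K = 1` for a real quadratic field with `d_K < 16`** (`d_K = 5, 8, 12, 13`): Minkowski's bound, in Mathlib's
form `|d_K| < (2 (π/4)^{r₂} nⁿ/n!)² = 16` (`n = 2`, `r₂ = 0`) ⇒ `𝓞 K` is principal. [cite: JacobsonWilliams2008, §5.3 (p. 112 and (5.33)–(5.34))] -/
theorem classNumber_eq_one_of_discr_pos_lt_sixteen (h2 : finrank ℚ K = 2) (hd : 0 < NumberField.discr K)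
    (h16 : NumberField.discr K < 16) : NumberField.classNumber K = 1 := by
  obtain ⟨-, hc0⟩ := nrRealPlaces_eq_two_and_nrComplexPlaces_eq_zero h2 hd
  rw [NumberField.classNumber_eq_one_iff]
  apply RingOfIntegers.isPrincipalIdealRing_of_abs_discr_lt
  rw [hc0, h2, abs_of_pos hd]
  have : ((NumberField.discr K : ℤ) : ℝ) < 16 := by exact_mod_cast h16
  norm_num [Nat.factorial]
  linarith

/-- `d_K = 5`: `h_K · R_K = log ((1 + √5)/2)`. [cite: JacobsonWilliams2008, §3.3 Table 3.1] -/
theorem classNumber_mul_regulator_of_discr_eq_five (h2 : finrank ℚ K = 2) (hd : NumberField.discr K = 5) :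
    (NumberField.classNumber K : ℝ) * regulator K = Real.log ((1 + 1 * Real.sqrt 5) / 2) := by
  rw [classNumber_eq_one_of_discr_pos_lt_sixteen h2 (by rw [hd]; norm_num) (by rw [hd]; norm_num),
    regulator_of_discr_eq_five h2 hd, Nat.cast_one, one_mul]

/-- `d_K = 8`: `h_K · R_K = log (1 + √2)`. [cite: JacobsonWilliams2008, §3.3 Table 3.1] -/
theorem classNumber_mul_regulator_of_discr_eq_eight (h2 : finrank ℚ K = 2) (hd : NumberField.discr K = 8) :
    (NumberField.classNumber K : ℝ) * regulator K = Real.log ((2 + 1 * Real.sqrt 8) / 2) := by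
  rw [classNumber_eq_one_of_discr_pos_lt_sixteen h2 (by rw [hd]; norm_num) (by rw [hd]; norm_num),
    regulator_of_discr_eq_eight h2 hd, Nat.cast_one, one_mul]

/-- `d_K = 12`: `h_K · R_K = log (2 + √3)`. [cite: JacobsonWilliams2008, §3.3 Table 3.1] -/
theorem classNumber_mul_regulator_of_discr_eq_twelve (h2 : finrank ℚ K = 2) (hd : NumberField.discr K = 12) :
    (NumberField.classNumber K : ℝ) * regulator K = Real.log ((4 + 1 * Real.sqrt 12) / 2) := by
  rw [classNumber_eq_one_of_discr_pos_lt_sixteen h2 (by rw [hd]; norm_num) (by rw [hd]; norm_num),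
    regulator_of_discr_eq_twelve h2 hd, Nat.cast_one, one_mul]

/-- `d_K = 13`: `h_K · R_K = log ((3 + √13)/2)`. [cite: JacobsonWilliams2008, §3.3 Table 3.1] -/
theorem classNumber_mul_regulator_of_discr_eq_thirteen (h2 : finrank ℚ K = 2) (hd : NumberField.discr K = 13) :
    (NumberField.classNumber K : ℝ) * regulator K = Real.log ((3 + 1 * Real.sqrt 13) / 2) := by
  rw [classNumber_eq_one_of_discr_pos_lt_sixteen h2 (by rw [hd]; norm_num) (by rw [hd]; norm_num),
    regulator_of_discr_eq_thirteen h2 hd, Nat.cast_one, one_mul]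

end Quadratic

end Literature.NumberTheory.QuadraticFields

end
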